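import Summits.QuantumFields.BalabanUV.Beta.FP.GaugeMultiplierBiLaplace
import Summits.QuantumFields.BalabanUV.Beta.FP.BiLaplaceResponseIsMultiplier

/-!
# `BalabanUV.Beta.FP.GaugeMultiplierTwoLevelResponse` — road «FP» for binder row D1, DESIGN ROW **GHOST-STEP**, the (g1) COROLLARY asked for by the
# OWNER d1-p3 gen 13 (`N2B-DESIGN.md` v1.4 §8, journal MEMO l.32437: «Successor∕any leaf (S-sized, first refusal d1-formalise leaves) … the typed corollary»):
# THE GAUGE-MULTIPLIER TWO-LEVEL DEFECT IN RESPONSE FORM, IN an2's OBJECTS ONLY —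
# `GamM_{N′}(z; l, x′) − GamM_M(z; l, x′) = Σ'_y blockSum_M(SbCol_{N′} z)(y) · (dz Wb_M(y, ·))(l, x′)` for `N′ = M·L` (every `d`); UNCONDITIONAL

HONEST DEPENDENCY (page 1, mandatory): continuum YM on T⁴ ⇐ BetaPertH ∧ nine spine estimates (0/9 proved); BetaPertH ⇐ (D1) ∧ (D4) ∧ CAP+tail;
G-an2-4 gates asym, D1 and NE2/3/4.  HONEST FRAMING (cell contract, verbatim): «discharging `BetaPertH` makes Bałaban's UV stability UNCONDITIONAL —
a real constructive-QFT result; it is NOT the continuum limit and NOT the Clay problem.»  THIS MODULE is [folklore]-grade bookkeeping (one lattice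
gradient pushed through an absolutely convergent block series) over the owner's `GaugeMultiplierBiLaplace` (p275731 ✓: `Mcol_eq_neg_dz_SbCol`,
`GamM = −dz SbCol`) and `BiLaplaceResponseIsMultiplier` (p282108: `SbCol_sub_eq_neg_tsum_Wb`, the scalar two-level law with `Hb = −Wbᵀ`), an2-g6's
`BiLaplaceBlockKKT` ∕ `BiLaplaceBlockGreen` (`Sb`, `Wb`, `SbCol`, `WbAdj`, `WbAdj_bdd`, `SbCol_bdd_summable`) and an5's `KKTFluctuationEnergy.summable_blocks` ∕
`ResolventCompositionStepB.dz_tsum` BY NAME; no `def`, no `def … : Prop`, nothing cited, 0 sorry.  0∕4 row-D1 binders; discharges NO (CONV-C) row ((g3) is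
gan24-p3's); NOT SDF, NOT D1, NOT BetaPertH, NOT continuum, NOT Clay.  «not in print; our bookkeeping».

ABSOLUTE RULE (cell charter, verbatim): «No internally-minted statement may enter as a cited fact. Every hypothesis is either kernel-proved in this
package or a verbatim quotation of a PUBLISHED theorem with page reference. The manuscript(s) under audit are NOT citable for their own disputed
steps — they are the thing under adjudication; programme-internal (2001/route/tribunal) claims are never citable.»

WHY (memo `N2B-DESIGN.md` v1.3 §6–§7, v1.4 §8).  The surviving defect words of road FP's (STEP) door are, by the owner's `pair_twoLevelDefect` (p277645 ✓),
contact terms × the typed slice's Faddeev–Popov Green kernel (`θ_y` = sums of an2's `SbCol`) × the dressed partner's gauge quantity; their force legs are the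
gauge multipliers `GamM_N(z; l, x′) = Mcol_N l x′ z`.  With `GamM = −dz SbCol` (p275731) and the scalar two-level law in an2's objects (p282108,
`Sb_{N′}(x, x′) − Sb_M(x, x′) = −Σ_y blockSum_M(Sb_{N′}(·, x′))(y)·Wb_M(y, x)`), the TWO-LEVEL DEFECT OF THE GAUGE MULTIPLIER is the `M`-level multiplier
kernel's force-leg gradient, superposed over the `M`-block sums of the fine Green column — the shape GHOST-STEP (g2)∕(g4) consume, and the reason (g3)
«(CONV-C)-Sb» needs the PAIR (`Sb`, `Wb`) and nothing else (memo v1.4 §8).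

CONTENT (generic `d`; `N′ = M·L` displayed as `hN`; every identity UNCONDITIONAL):
* §1 letters: `Wb_bdd` (an2's multiplier kernel is uniformly bounded — `WbAdj_bdd` read at `x = N•y`; the owner's draft name and shape), `summable_blockSum_SbCol`
  (the `M`-block sums of a fine Green column are summable — `summable_blocks`), `summable_blockSum_SbCol_mul` ∕ `summable_blockSum_SbCol_mul_Wb` (summable × bounded).
* §2 **`dz_SbCol_sub_eq_neg_tsum`**: `dz (SbCol_{N′} z − SbCol_M z) = −Σ'_y blockSum_M(SbCol_{N′} z)(y) · dz (Wb_M y ·)` (p282108 under `dz_tsum`);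
  **`Mcol_sub_eq_tsum_blockSum_dz_Wb`**: `Mcol_{N′} l x′ z − Mcol_M l x′ z = Σ'_y blockSum_M(SbCol_{N′} z)(y) · (dz (Wb_M y ·)) l x′`;
  **`GamM_sub_eq_tsum`** (THE OWNER's HEADLINE SHAPE, `drafts/GaugeMultiplierTwoLevelResponse.owner-draft.rc0.lean`, token for token):
  `GamM_{N′} z l x′ − GamM_M z l x′ = Σ'_y blockSum_M(SbCol_{N′} z)(y) · dz (fun x ↦ Wb_M y x) l x′`; `GamM_sub_eq_tsum_blockSum_Wb` (the same with `dz` expanded: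
  `… · (Wb_M y (x′ + e_l) − Wb_M y x′)`); `forceLeg_sub_eq_dz_tsum` (the two-level defect of the force leg IS a gradient: `dz` of `u ↦ Σ'_y blockSum_M(SbCol_{N′} z)(y)·Wb_M y u`).
Provenance: D1 formalisation swarm LEAF PROVER 06, unit b2b-balaban-beta-d1-formalise-leaf-06 gen 14 (prover-b2b-balaban-beta-d1-formalise-leaf-06-g14-0),
2026-08-21 (journal MINE l.32476, INTENT 1 l.32521; names `Wb_bdd` ∕ `summable_blockSum_SbCol_mul_Wb` ∕ `GamM_sub_eq_tsum` aligned with the owner's shared draft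
`HOME/b2b-balaban-beta-d1-p3/drafts/GaugeMultiplierTwoLevelResponse.owner-draft.rc0.lean`, conclusions token-identical); no existing file touched.
-/

noncomputable section

namespace Summit.QuantumFields.BalabanUV.Beta.FP.GaugeMultiplierTwoLevelResponse

open Literature.MathematicalPhysics.QuantumFieldTheory
open Literature.MathematicalPhysics.QuantumFieldTheory.Balaban1983to89
open Literature.MathematicalPhysics.QuantumFieldTheory.Balaban1983to89.Beta
open AffineAveraging (Form0 Form1 unitVec dz blockSum)
open KKTFluctuationKernel (GamM)
open KKTFluctuationEnergy (Mcol summable_mul_of_bdd' summable_blocks)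
open ResolventComposition (quo_zsmul')
open ResolventCompositionStepB (dz_tsum)
open BiLaplaceBlockKKT (Wb)
open BiLaplaceBlockGreen (SbCol WbAdj WbAdj_bdd SbCol_bdd_summable)
open GaugeMultiplierBiLaplace (Mcol_eq_neg_dz_SbCol)
open BiLaplaceResponseIsMultiplier (SbCol_sub_eq_neg_tsum_Wb)

variable {d : ℕ}

/-! ## §1 Letters: the multiplier kernel is bounded, the block sums of a Green column are summable -/

section Letters

variable {N : ℕ} [NeZero N]

/-- [folklore] an2's multiplier kernel `Wb_N(y, x)` is uniformly bounded in both arguments (`WbAdj_bdd` read at the block-base point `N•y`,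
`quo N (N•y) = y`). -/
theorem Wb_bdd : ∃ C : ℝ, 0 ≤ C ∧ ∀ (y x : AffineAveraging.Site (d + 1)), |Wb (N := N) y x| ≤ C := by
  obtain ⟨C, hC, h⟩ := WbAdj_bdd (N := N) (d := d)
  refine ⟨C, hC, fun y x => ?_⟩
  have e : Wb (N := N) y x = WbAdj (N := N) x ((N : ℤ) • y) := by
    rw [WbAdj, quo_zsmul']
  rw [e]
  exact h x _

/-- [folklore] The `M`-block sums of a (summable) fine Green column form a summable coarse family (`summable_blocks`). -/
theorem summable_blockSum_SbCol (M : ℕ) [NeZero M] (z : AffineAveraging.Site (d + 1)) : Summable (blockSum M (SbCol (N := N) z)) := by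
  obtain ⟨C, _, _, hSs⟩ := SbCol_bdd_summable (N := N) (d := d)
  exact summable_blocks (N := M) (hSs z)

variable {M : ℕ} [NeZero M]

/-- [folklore] Summable block sums × an arbitrary bounded coarse weight: summable. -/
theorem summable_blockSum_SbCol_mul {g : Form0 (d + 1) ℝ} {B : ℝ} (hg : ∀ y, |g y| ≤ B) (z : AffineAveraging.Site (d + 1)) :
    Summable (fun y => blockSum M (SbCol (N := N) z) y * g y) :=
  summable_mul_of_bdd' (summable_blockSum_SbCol (N := N) M z) hg

/-- [folklore] In particular against the level-`M` multiplier kernel read at any fine point `x`: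
`y ↦ blockSum_M(SbCol_N z)(y) · Wb_M(y, x)` is summable. -/
theorem summable_blockSum_SbCol_mul_Wb (z x : AffineAveraging.Site (d + 1)) :
    Summable (fun y => blockSum M (SbCol (N := N) z) y * Wb (N := M) y x) := by
  obtain ⟨C, _, hW⟩ := Wb_bdd (N := M) (d := d)
  exact summable_blockSum_SbCol_mul (N := N) (fun y => hW y x) z

end Letters

/-! ## §2 The two-level defect of the gauge multiplier in response form -/

section TwoLevel

variable {N' M L : ℕ} [NeZero N'] [NeZero M] [NeZero L]

/-- [our proof] **THE GRADIENT OF THE SCALAR TWO-LEVEL LAW** (`N′ = M·L`): as 1-forms in the force bond,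
`dz (SbCol_{N′} z − SbCol_M z) = −(fun l x′ ↦ Σ'_y blockSum_M(SbCol_{N′} z)(y) · (dz (Wb_M y ·)) l x′)` — p282108's `SbCol_sub_eq_neg_tsum_Wb` with the lattice
gradient pushed through the absolutely convergent `y`-series (`dz_tsum`; summability §1). -/
theorem dz_SbCol_sub_eq_neg_tsum (hN : N' = M * L) (z : AffineAveraging.Site (d + 1)) :
    dz (SbCol (N := N') z - SbCol (N := M) z)
      = fun l x' => -∑' y, blockSum M (SbCol (N := N') z) y * dz (fun u => Wb (N := M) y u) l x' := by
  have hfun : SbCol (N := N') z - SbCol (N := M) z = fun x => ∑' y, -(blockSum M (SbCol (N := N') z) y * Wb (N := M) y x) := by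
    funext x
    rw [Pi.sub_apply, SbCol_sub_eq_neg_tsum_Wb hN z x, tsum_neg]
  have hs : ∀ x, Summable fun y => -(blockSum M (SbCol (N := N') z) y * Wb (N := M) y x) :=
    fun x => (summable_blockSum_SbCol_mul_Wb (N := N') (M := M) z x).neg
  rw [hfun, dz_tsum hs]
  funext l x'
  rw [← tsum_neg]
  refine tsum_congr fun y => ?_
  simp only [dz]
  ring

/-- [our proof] **THE GAUGE-MULTIPLIER TWO-LEVEL DEFECT IN RESPONSE FORM** (`N′ = M·L`, every `d`, every source bond `(l, x′)`, every fine site `z`):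
`Mcol_{N′} l x′ z − Mcol_M l x′ z = Σ'_y blockSum_M(SbCol_{N′} z)(y) · (dz (Wb_M y ·)) l x′` — the owner's `Mcol_eq_neg_dz_SbCol` (`GamM = −dz SbCol`, p275731)
at both levels + `dz_SbCol_sub_eq_neg_tsum`.  IN an2's OBJECTS ONLY: the fine Green column's `M`-block sums superposed against the force-leg gradient of the
level-`M` multiplier kernel. -/
theorem Mcol_sub_eq_tsum_blockSum_dz_Wb (hN : N' = M * L) (l : Fin (d + 1)) (x' z : AffineAveraging.Site (d + 1)) :
    Mcol (N := N') l x' z - Mcol (N := M) l x' z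
      = ∑' y, blockSum M (SbCol (N := N') z) y * dz (fun u => Wb (N := M) y u) l x' := by
  have h := congrFun (congrFun (dz_SbCol_sub_eq_neg_tsum (N' := N') (M := M) (L := L) hN z) l) x'
  have hsplit : dz (SbCol (N := N') z - SbCol (N := M) z) l x' = dz (SbCol (N := N') z) l x' - dz (SbCol (N := M) z) l x' := by
    simp only [dz, Pi.sub_apply]
    ring
  rw [Mcol_eq_neg_dz_SbCol (N := N'), Mcol_eq_neg_dz_SbCol (N := M)]
  rw [hsplit] at h
  linarith

/-- [our proof] **THE TWO-LEVEL LAW OF THE TYPED GAUGE MULTIPLIER IN an2's OBJECTS ONLY — THE OWNER's HEADLINE SHAPE** (`N′ = M·L`;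
`Mcol_N l x′ z = GamM_N(z; l, x′)` definitionally): `GamM_{N′}(z; l, x′) − GamM_M(z; l, x′) = Σ'_y blockSum_M(SbCol_{N′} z)(y) · (dz Wb_M(y, ·))(l, x′)`. -/
theorem GamM_sub_eq_tsum (hN : N' = M * L) (z : AffineAveraging.Site (d + 1)) (l : Fin (d + 1)) (x' : AffineAveraging.Site (d + 1)) :
    GamM (N := N') z l x' - GamM (N := M) z l x'
      = ∑' y, blockSum M (SbCol (N := N') z) y * dz (fun x => Wb (N := M) y x) l x' :=
  Mcol_sub_eq_tsum_blockSum_dz_Wb (N' := N') (M := M) (L := L) hN l x' z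

/-- [our proof] **THE SAME IN an2's KERNEL LETTERS** (`Mcol_N l x′ z = GamM_N(z; l, x′)`, `dz` expanded):
`GamM_{N′}(z; l, x′) − GamM_M(z; l, x′) = Σ'_y blockSum_M(SbCol_{N′} z)(y) · (Wb_M(y, x′ + e_l) − Wb_M(y, x′))`. -/
theorem GamM_sub_eq_tsum_blockSum_Wb (hN : N' = M * L) (z : AffineAveraging.Site (d + 1)) (l : Fin (d + 1)) (x' : AffineAveraging.Site (d + 1)) :
    GamM (N := N') z l x' - GamM (N := M) z l x'
      = ∑' y, blockSum M (SbCol (N := N') z) y * (Wb (N := M) y (x' + unitVec l) - Wb (N := M) y x') := by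
  have h := Mcol_sub_eq_tsum_blockSum_dz_Wb (N' := N') (M := M) (L := L) hN l x' z
  simp only [Mcol, dz] at h
  exact h

/-- [our proof] **THE TWO-LEVEL DEFECT OF THE FORCE LEG IS PURE GAUGE, WITH AN EXPLICIT POTENTIAL**: as a 1-form in the force bond,
`(l, x′) ↦ Mcol_{N′} l x′ z − Mcol_M l x′ z` is `dz` of the fine 0-form `u ↦ Σ'_y blockSum_M(SbCol_{N′} z)(y) · Wb_M(y, u)` (the series and the gradient
commute by `dz_tsum`; cf. the owner's one-level `forceLeg_eq_dz`). -/
theorem forceLeg_sub_eq_dz_tsum (hN : N' = M * L) (z : AffineAveraging.Site (d + 1)) :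
    (fun l x' => Mcol (N := N') l x' z - Mcol (N := M) l x' z)
      = dz (fun u => ∑' y, blockSum M (SbCol (N := N') z) y * Wb (N := M) y u) := by
  rw [dz_tsum (fun u => summable_blockSum_SbCol_mul_Wb (N := N') (M := M) z u)]
  funext l x'
  rw [Mcol_sub_eq_tsum_blockSum_dz_Wb (N' := N') (M := M) (L := L) hN l x' z]
  refine tsum_congr fun y => ?_
  simp only [dz]
  ring

end TwoLevel

end Summit.QuantumFields.BalabanUV.Beta.FP.GaugeMultiplierTwoLevelResponse

end
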